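import Literature.MathematicalPhysics.QuantumFieldTheory.Balaban1983to89.AveragingRT
import Literature.MathematicalPhysics.QuantumFieldTheory.Balaban1983to89.B10Eq27TorusAxialLog
import HarnessLib

/-!
# S2β · `hFlat` road, brick (ii-a⁺) of UV3-NODE §57.8 — THE WHITNEY HAT WEIGHTS OF ONE AVERAGING STEP ON THE `Setup` TORUS:
# partition of unity on every fine bond, hat mass EXACTLY `L^d` per coarse bond, concentration on the centre line, locality

Cell `ym3-torus` (rung R3 = continuum `SU(2)` Yang–Mills on the three-torus — NOT d = 4, NOT infinite volume, NOT a mass gap, NOT Clay).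
Width seat «width 12» `ym3-torus-px12` (gen 23), FREE px helper on crux `stmt-QuantumFields-20520` (`Theses.UnitScaleTilt.FluctuationComparisonRegPrIntL`),
count-neutral, DEFINITION-FREE (the weights are a plain function `w : PBond P t → PBond P (t+1) → ℝ` pinned by the displayed formula `hw`; no `def`,
no `instance`, no `notation`, default heartbeats).

WHY (UV3-NODE §57.8 (B)(D), px8 g21; GO 07:14:09Z).  The nonlinear assembly of the depth-uniform flat letter `hFlat` is the recursion
`B_t ≤ √L·(1 + ε_t)·B_{t+1} + R_t` over the averaging tower; its factor `√L` is the `ℓ²` cost (R1) of LIFTING the level-`(t+1)` field to level `t` by the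
geodesic Whitney-type interpolation `V b = expPoint (Σ_e w b e • L⁻¹ • log X e)`.  ✓`…S2BetaGeodesicJensenLift.sum_sq_norm_logVec_lift_le` (brick (ii-a))
proves (R1) for ABSTRACT finsets and weights under three hypotheses — `w ≥ 0`, `Σ_e w b e = 1` on every fine bond, `Σ_b w b e ≤ Λ` on every coarse bond —
and leaves the lattice object to its typist.  THIS FILE is the torus side of that object: the weights of ONE averaging step `T^{(t)} → T^{(t+1)}` of the
`Setup` tower (centred blocks of odd side `L`, standing range `t + 1 ≤ m + K`) and the three hypotheses BY KERNEL with `Λ = L^d` EXACTLY; the companion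
`…S2BetaWhitneyHatLift` puts the `SU(2)` variables on them.

THE WEIGHTS (`hw`, the displayed formula every theorem takes as hypothesis).  For a fine bond `b = ⟨x, μ⟩` and a coarse bond `e = ⟨y, μ′⟩`, with
`ρ := rel (emb y) x` the centred coordinatewise representative of `x − centre(y)` (lit ✓`B10Eq27TorusAxialLog.rel`):
    `w b e = [μ′ = μ] · [(x_μ − centre(y)_μ).val < L] · Π_{ν ≠ μ} (1 − |ρ_ν|∕L)₊`
— the LONGITUDINAL factor selects the coarse bond whose half-open slab `[centre(y), centre(y) + L·e_μ)` contains `b` (so the `L` fine bonds of the centre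
line of `e` belong to `e`), the TRANSVERSAL factors are the product hats of the coarse cube column through `b` (bilinear in `d = 3`).  These are the
lowest-order Whitney edge weights of the coarse cubical complex whose vertices are the block centres; they are NON-NEGATIVE (so Jensen applies — unlike the
signed «dual Whitney» profiles of ✓`UnitScaleTilt…DualWhitney1D∕3D`, which invert the BOX×LINE average linearly and are a different object).

CONTENTS.
* §1 the discrete circle `ℤ∕N` with `N = N′L` and `N′ ≥ 2` centres `y·L + h` (`h < L`): `exists_centre_add` (every point is `centre + k`, `k < L`),
  `sub_centre_add`∕`val_sub_centre_add` (seen from the centre `j` steps on, the point is `k + (N′−j)L`), ★`sum_longSel_eq_one` (LONGITUDINAL partition of unity: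
  exactly one slab), `natAbs_valMinAbs_offset`, ★`sum_hat_eq_one` (TRANSVERSAL partition of unity: the two nearest centres give `1 − k∕L` and `k∕L`, all others
  are at distance `≥ L`).
* §2 on `PBond`: `sum_pbond`, `hatW_nonneg`, `sum_hatW_eq_sum_src`, ★★`sum_hatW_eq_one` (`Σ_e w b e = 1`, a coordinatewise product of §1 via `Fintype.prod_sum`),
  `hatW_congr`∕`sum_hatW_src_eq` (coarse translation invariance), ★★`sum_hatW_eq_pow` (`Σ_b w b e = L^d` EXACTLY, by DOUBLE COUNTING: the partition of unity summed
  over the `(N′L)^d` parallel fine bonds against translation invariance over the `N′^d` centres — no interval sums), ★`hatW_line_self`∕`hatW_line_of_ne`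
  (on the centre line of `e` the weight is `1` on `e` and `0` elsewhere), ★`hatW_support` (locality: `w b e ≠ 0 ⟹ e ∥ b`, `0 ≤ ρ_μ < L`, `|ρ_ν| < L`).

HONEST SCOPE.  Finite sums on the `Setup` torus; no group, no field, no analysis; nothing of Bałaban's is asserted ([Balaban1985RegularSpaces] (1.29) p.81 and
[Balaban1984PropagatorsI] (1.7)–(1.8) p.18 are the printed loci of the interpolation ∕ contour geometry these weights serve); `hFlat`, TUBE-REG∘, GAP♯∘
(`stub_uniformFibreGapOrbit`), S2β, crux 20520 and `YM3TorusSU2` are NOT proved; no registered stub is closed; the Yang–Mills mass gap is NOT proved.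
References: T. Bałaban, CMP **99** (1985) [Balaban1985RegularSpaces]; CMP **95** (1984) [Balaban1984PropagatorsI]; CMP **109** (1987) [Balaban1987RG1] ((0.1)–(0.3)).
-/

set_option autoImplicit false

namespace Summit.QuantumFields.YangMills.Theorems.FluctuationComparisonRegPrIntLS2BetaWhitneyHatWeights

open Finset
open Literature.MathematicalPhysics.QuantumFieldTheory.Balaban1983to89
open B10Eq27TorusAxialLog (rel rel_apply)
open AveragingRT (line lineSite half_lt)

/-! ## §1 The discrete circle `ℤ∕(N′L)` with `N′` centres spaced `L` apart -/

section Circle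

variable {N N' L : ℕ}

/-- Every point of the circle `ℤ∕(N′L)` is `centre + k` for a centre label `y₀ ∈ ℤ∕N′` (centres at `y·L + h`, `h < L`) and an offset `k < L`. [folklore] -/
theorem exists_centre_add (hN : N = N' * L) (hN' : 0 < N') (hL : 0 < L) {h : ℕ} (hh : h < L) (x : ZMod N) :
    ∃ (y₀ : ZMod N') (k : ℕ), k < L ∧ x = ((y₀.val * L + h : ℕ) : ZMod N) + (k : ZMod N) := by
  subst hN
  haveI : NeZero (N' * L) := ⟨(Nat.mul_pos hN' hL).ne'⟩
  haveI : NeZero N' := ⟨hN'.ne'⟩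
  set a := x.val with ha
  have haN : a < N' * L := ZMod.val_lt x
  by_cases hha : h ≤ a
  · -- no wrap-around: centre label `(a − h) / L`, offset `(a − h) % L`
    refine ⟨(((a - h) / L : ℕ) : ZMod N'), (a - h) % L, Nat.mod_lt _ hL, ?_⟩
    have hq : (a - h) / L < N' := by rw [Nat.div_lt_iff_lt_mul hL]; omega
    rw [ZMod.val_natCast_of_lt hq]
    have : ((a - h) / L * L + h : ℕ) + (a - h) % L = a := by have := Nat.div_add_mod' (a - h) L; omega
    rw [← Nat.cast_add, this, ha, ZMod.natCast_zmod_val]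
  · -- wrap-around: the last centre `N′ − 1`, offset `a + L − h`
    push Not at hha
    refine ⟨((N' - 1 : ℕ) : ZMod N'), a + L - h, by omega, ?_⟩
    rw [ZMod.val_natCast_of_lt (by omega)]
    have : ((N' - 1) * L + h : ℕ) + (a + L - h) = N' * L + a := by
      have : (N' - 1) * L + L = N' * L := by rw [← Nat.succ_mul]; congr 1; omega
      omega
    rw [← Nat.cast_add, this, Nat.cast_add, ZMod.natCast_self, zero_add, ha, ZMod.natCast_zmod_val]

/-- The centre labelled `y₀ + y` sits at `(y₀.val + y.val)·L + h` on the circle (reduction of the label mod `N′` is invisible mod `N′L`). [folklore] -/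
theorem centre_add (hN : N = N' * L) (hN' : 0 < N') (h : ℕ) (y₀ y : ZMod N') :
    (((y₀ + y).val * L + h : ℕ) : ZMod N) = (((y₀.val + y.val) * L + h : ℕ) : ZMod N) := by
  subst hN
  haveI : NeZero N' := ⟨hN'.ne'⟩
  rw [ZMod.val_add, Nat.cast_add, Nat.cast_add, ← Nat.mul_mod_mul_right, ZMod.natCast_mod]

/-- The difference `x − centre(y₀ + y)` for `x = centre(y₀) + k`: it is `k + (N′ − y.val)·L` on the circle. [folklore] -/
theorem sub_centre_add (hN : N = N' * L) (hN' : 0 < N') {h k : ℕ} {x : ZMod N} {y₀ : ZMod N'}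
    (hx : x = ((y₀.val * L + h : ℕ) : ZMod N) + (k : ZMod N)) (y : ZMod N') :
    x - (((y₀ + y).val * L + h : ℕ) : ZMod N) = ((k + (N' - y.val) * L : ℕ) : ZMod N) := by
  subst hN
  haveI : NeZero N' := ⟨hN'.ne'⟩
  have hy : y.val < N' := ZMod.val_lt y
  rw [centre_add rfl hN', hx]
  have e1 : (k + (N' - y.val) * L : ℕ) + ((y₀.val + y.val) * L + h) = (y₀.val * L + h) + k + N' * L := by
    have : (N' - y.val) * L + y.val * L = N' * L := by rw [← Nat.add_mul]; congr 1; omega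
    nlinarith [this]
  have e2 : ((k + (N' - y.val) * L : ℕ) : ZMod (N' * L)) + (((y₀.val + y.val) * L + h : ℕ) : ZMod (N' * L))
      = ((y₀.val * L + h : ℕ) : ZMod (N' * L)) + (k : ZMod (N' * L)) := by
    rw [← Nat.cast_add, e1, Nat.cast_add, Nat.cast_add, ZMod.natCast_self, add_zero]
  rw [← e2, add_sub_cancel_right]

/-- Its label representative: `val (x − centre(y₀ + y)) = k + (N′ − y.val)·L` for `y ≠ 0`, and `= k` for `y = 0`. [folklore] -/
theorem val_sub_centre_add (hN : N = N' * L) (hN' : 0 < N') {h k : ℕ} (hk : k < L) {x : ZMod N} {y₀ : ZMod N'}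
    (hx : x = ((y₀.val * L + h : ℕ) : ZMod N) + (k : ZMod N)) {y : ZMod N'} (hy : y ≠ 0) :
    (x - (((y₀ + y).val * L + h : ℕ) : ZMod N)).val = k + (N' - y.val) * L := by
  subst hN
  haveI : NeZero N' := ⟨hN'.ne'⟩
  have hyN : y.val < N' := ZMod.val_lt y
  have hy0 : 0 < y.val := Nat.pos_of_ne_zero fun h0 => hy ((ZMod.val_eq_zero y).mp h0)
  rw [sub_centre_add rfl hN' hx, ZMod.val_natCast_of_lt]
  calc k + (N' - y.val) * L < L + (N' - y.val) * L := by omega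
    _ = (N' - y.val + 1) * L := by ring
    _ ≤ N' * L := Nat.mul_le_mul_right _ (by omega)

/-- … and `= k` for `y = 0`. [folklore] -/
theorem val_sub_centre_self (hN : N = N' * L) (hL2 : 2 * L ≤ N' * L) {h k : ℕ} (hk : k < L) {x : ZMod N} {y₀ : ZMod N'}
    (hx : x = ((y₀.val * L + h : ℕ) : ZMod N) + (k : ZMod N)) :
    (x - ((y₀.val * L + h : ℕ) : ZMod N)).val = k := by
  subst hN
  rw [hx, add_sub_cancel_left, ZMod.val_natCast_of_lt (by omega)]

/-- **LONGITUDINAL PARTITION OF UNITY**: every point of the circle lies in the half-open slab `[centre, centre + L)` of EXACTLY ONE centre. [folklore] -/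
theorem sum_longSel_eq_one [NeZero N'] (hN : N = N' * L) (hL2 : 2 * L ≤ N' * L) {h : ℕ} (hh : h < L) (x : ZMod N) :
    ∑ y : ZMod N', (if (x - ((y.val * L + h : ℕ) : ZMod N)).val < L then (1 : ℝ) else 0) = 1 := by
  have hN' : 0 < N' := Nat.pos_of_ne_zero (NeZero.ne N')
  have hL : 0 < L := by omega
  obtain ⟨y₀, k, hk, hx⟩ := exists_centre_add hN hN' hL hh x
  rw [← Fintype.sum_equiv (Equiv.addLeft y₀)
    (fun y => if (x - (((y₀ + y).val * L + h : ℕ) : ZMod N)).val < L then (1 : ℝ) else 0) _ (fun _ => rfl)]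
  rw [Finset.sum_eq_single (0 : ZMod N')]
  · rw [add_zero, val_sub_centre_self hN hL2 hk hx, if_pos hk]
  · intro y _ hy
    rw [val_sub_centre_add hN hN' hk hx hy, if_neg]
    have : y.val < N' := ZMod.val_lt y
    have : 1 ≤ N' - y.val := by omega
    nlinarith
  · exact fun h0 => absurd (Finset.mem_univ _) h0

/-- The distance to the circle's origin of `k + (N′ − j)·L` (`0 ≤ k < L`, `1 ≤ j < N′`) is `min (k + (N′−j)L) (jL − k)`. [folklore] -/
theorem natAbs_valMinAbs_offset (hN : N = N' * L) (hN' : 0 < N') {k j : ℕ} (hk : k < L) (hj1 : 1 ≤ j) (hjN : j < N') :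
    (((k + (N' - j) * L : ℕ) : ZMod N)).valMinAbs.natAbs = min (k + (N' - j) * L) (j * L - k) := by
  subst hN
  have hL : 0 < L := by omega
  haveI : NeZero (N' * L) := ⟨(Nat.mul_pos hN' hL).ne'⟩
  have hlt : k + (N' - j) * L < N' * L := by
    calc k + (N' - j) * L < L + (N' - j) * L := by omega
      _ = (N' - j + 1) * L := by ring
      _ ≤ N' * L := Nat.mul_le_mul_right _ (by omega)
  rw [ZMod.valMinAbs_natAbs_eq_min, ZMod.val_natCast_of_lt hlt]
  congr 1
  have : (N' - j) * L + j * L = N' * L := by rw [← Nat.add_mul]; congr 1; omega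
  omega

/-- **TRANSVERSAL PARTITION OF UNITY**: the hats `(1 − |x − centre|∕L)₊` of the `N′ ≥ 2` centres sum to `1` at every point of the circle
(the two nearest centres contribute `1 − k∕L` and `k∕L`, every other centre is at distance `≥ L`). [folklore] -/
theorem sum_hat_eq_one [NeZero N'] (hN : N = N' * L) (hN' : 2 ≤ N') {h : ℕ} (hh : h < L) (x : ZMod N) :
    ∑ y : ZMod N', max 0 (1 - (((x - ((y.val * L + h : ℕ) : ZMod N)).valMinAbs.natAbs : ℕ) : ℝ) / L) = 1 := by
  have hN'0 : 0 < N' := by omega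
  haveI : Fact (1 < N') := ⟨by omega⟩
  have hL : 0 < L := by omega
  haveI : NeZero N := ⟨by rw [hN]; exact (Nat.mul_pos hN'0 hL).ne'⟩
  have hLr : (0 : ℝ) < L := by exact_mod_cast hL
  obtain ⟨y₀, k, hk, hx⟩ := exists_centre_add hN hN'0 hL hh x
  rw [← Fintype.sum_equiv (Equiv.addLeft y₀)
    (fun y => max 0 (1 - (((x - (((y₀ + y).val * L + h : ℕ) : ZMod N)).valMinAbs.natAbs : ℕ) : ℝ) / L)) _ (fun _ => rfl)]
  rw [Finset.sum_eq_add (0 : ZMod N') 1 zero_ne_one]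
  · -- the two nearest centres
    have h0 : (x - (((y₀ + 0).val * L + h : ℕ) : ZMod N)).valMinAbs.natAbs = k := by
      rw [add_zero, hx, add_sub_cancel_left, ZMod.valMinAbs_natCast_of_le_half, Int.natAbs_natCast]
      have : 2 * L ≤ N' * L := Nat.mul_le_mul_right _ hN'
      rw [Nat.le_div_iff_mul_le two_pos]; omega
    have h1 : (x - (((y₀ + 1).val * L + h : ℕ) : ZMod N)).valMinAbs.natAbs = L - k := by
      rw [sub_centre_add hN hN'0 hx, ZMod.val_one, natAbs_valMinAbs_offset hN hN'0 hk le_rfl (by omega), one_mul]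
      have : L ≤ (N' - 1) * L := Nat.le_mul_of_pos_left L (by omega)
      exact min_eq_right (by omega)
    rw [h0, h1, max_eq_right, max_eq_right]
    · rw [Nat.cast_sub hk.le]; field_simp; ring
    · rw [sub_nonneg, div_le_one hLr]; exact_mod_cast (Nat.sub_le L k)
    · rw [sub_nonneg, div_le_one hLr]; exact_mod_cast hk.le
  · -- every other centre is at distance ≥ L
    intro y _ hy
    have hyN : y.val < N' := ZMod.val_lt y
    have hy2 : 2 ≤ y.val := by
      rcases Nat.lt_or_ge y.val 2 with hlt | hge
      · exfalso
        interval_cases hv : y.val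
        · exact hy.1 ((ZMod.val_eq_zero y).mp hv)
        · exact hy.2 (by rw [← ZMod.natCast_zmod_val y, hv, Nat.cast_one])
      · exact hge
    rw [sub_centre_add hN hN'0 hx, natAbs_valMinAbs_offset hN hN'0 hk (by omega) hyN]
    have : L ≤ min (k + (N' - y.val) * L) (y.val * L - k) := by
      have : 1 ≤ N' - y.val := by omega
      have : 2 * L ≤ y.val * L := Nat.mul_le_mul_right _ hy2
      exact le_min (by nlinarith) (by omega)
    rw [max_eq_left (by rw [sub_nonpos, one_le_div hLr]; exact_mod_cast this)]
  · exact fun h0 => absurd (Finset.mem_univ _) h0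
  · exact fun h0 => absurd (Finset.mem_univ _) h0

end Circle

/-! ## §2 The hat weights of one averaging step on the `Setup` torus -/

section Weights

variable {P : Params} {t : ℕ}

/-- Sums over positively oriented bonds are sums over (initial point, direction). [folklore] -/
theorem sum_pbond {s : ℕ} (f : PBond P s → ℝ) : ∑ b, f b = ∑ x : Site P s, ∑ μ : Fin P.d, f ⟨x, μ⟩ := by
  rw [← Fintype.sum_prod_type']
  exact (Fintype.sum_equiv (⟨fun p => ⟨p.1, p.2⟩, fun b => (b.src, b.dir), fun _ => rfl, fun _ => rfl⟩ :
    Site P s × Fin P.d ≃ PBond P s) (fun p => f ⟨p.1, p.2⟩) f fun _ => rfl).symm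

/-- `2L ≤ |T^{(t)}|_ν` in the standing range. [folklore] -/
theorem two_mul_L_le_sitesPerDir (P : Params) (t : ℕ) : 2 * P.L ≤ P.sitesPerDir (t + 1) * P.L :=
  Nat.mul_le_mul_right _ (P.one_lt_sitesPerDir (t + 1))

/-- The centre of the block `y`, coordinate `ν`, is the circle point `y_ν·L + (L−1)∕2`. [cite: Balaban1987RG1, (0.1) p.252] -/
theorem emb_apply (y : Site P (t + 1)) (ν : Fin P.d) :
    emb y ν = (((y ν).val * P.L + (P.L - 1) / 2 : ℕ) : ZMod (P.sitesPerDir t)) := rfl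

/-- **THE WEIGHTS ARE NON-NEGATIVE.** [folklore] -/
theorem hatW_nonneg (w : PBond P t → PBond P (t + 1) → ℝ)
    (hw : ∀ b e, w b e = if e.dir = b.dir ∧ (b.src b.dir - emb e.src b.dir).val < P.L then
      ∏ ν ∈ Finset.univ.erase b.dir, max 0 (1 - ((rel (emb e.src) b.src ν).natAbs : ℝ) / P.L) else 0)
    (b : PBond P t) (e : PBond P (t + 1)) : 0 ≤ w b e := by
  rw [hw]; split_ifs
  exacts [Finset.prod_nonneg fun ν _ => le_max_left _ _, le_rfl]

/-- Only the coarse bonds PARALLEL to `b` carry weight, and the sum over them is a coordinatewise product of circle sums. [folklore] -/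
theorem sum_hatW_eq_sum_src (w : PBond P t → PBond P (t + 1) → ℝ)
    (hw : ∀ b e, w b e = if e.dir = b.dir ∧ (b.src b.dir - emb e.src b.dir).val < P.L then
      ∏ ν ∈ Finset.univ.erase b.dir, max 0 (1 - ((rel (emb e.src) b.src ν).natAbs : ℝ) / P.L) else 0)
    (b : PBond P t) : ∑ e, w b e = ∑ y : Site P (t + 1), w b ⟨y, b.dir⟩ := by
  rw [sum_pbond]
  refine Finset.sum_congr rfl fun y _ => ?_
  rw [Finset.sum_eq_single b.dir (fun μ _ hμ => by rw [hw, if_neg (fun h => hμ h.1)]) (fun h => absurd (Finset.mem_univ _) h)]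

/-- **PARTITION OF UNITY ON EVERY FINE BOND**: `Σ_e w b e = 1` (standing range `t + 1 ≤ m + K`). [cite: Balaban1985RegularSpaces, (1.29) p.81] -/
theorem sum_hatW_eq_one (ht : t + 1 ≤ P.m + P.K) (w : PBond P t → PBond P (t + 1) → ℝ)
    (hw : ∀ b e, w b e = if e.dir = b.dir ∧ (b.src b.dir - emb e.src b.dir).val < P.L then
      ∏ ν ∈ Finset.univ.erase b.dir, max 0 (1 - ((rel (emb e.src) b.src ν).natAbs : ℝ) / P.L) else 0)
    (b : PBond P t) : ∑ e, w b e = 1 := by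
  have hN := P.sitesPerDir_eq_mul_succ ht
  have hN' : 2 ≤ P.sitesPerDir (t + 1) := P.one_lt_sitesPerDir (t + 1)
  rw [sum_hatW_eq_sum_src w hw]
  -- each summand is a product over ALL coordinates of one-dimensional factors
  set F : Fin P.d → ZMod (P.sitesPerDir (t + 1)) → ℝ := fun ν a =>
    if ν = b.dir then (if (b.src ν - (((a.val * P.L + (P.L - 1) / 2 : ℕ) : ZMod (P.sitesPerDir t)))).val < P.L then 1 else 0)
    else max 0 (1 - (((b.src ν - ((a.val * P.L + (P.L - 1) / 2 : ℕ) : ZMod (P.sitesPerDir t))).valMinAbs.natAbs : ℕ) : ℝ) / P.L)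
    with hF
  have hterm : ∀ y : Site P (t + 1), w b ⟨y, b.dir⟩ = ∏ ν, F ν (y ν) := by
    intro y
    rw [hw, ← Finset.prod_erase_mul Finset.univ _ (Finset.mem_univ b.dir)]
    simp only [true_and, hF, if_true, emb_apply, rel_apply]
    split_ifs with hsel
    · rw [mul_one]
      exact Finset.prod_congr rfl fun ν hν => by rw [if_neg (Finset.ne_of_mem_erase hν)]
    · rw [mul_zero]
  calc ∑ y : Site P (t + 1), w b ⟨y, b.dir⟩ = ∑ y : Fin P.d → ZMod (P.sitesPerDir (t + 1)), ∏ ν, F ν (y ν) :=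
        Finset.sum_congr rfl fun y _ => hterm y
    _ = ∏ ν : Fin P.d, ∑ a : ZMod (P.sitesPerDir (t + 1)), F ν a := (Fintype.prod_sum F).symm
    _ = ∏ _ν : Fin P.d, (1 : ℝ) := by
        refine Finset.prod_congr rfl fun ν _ => ?_
        by_cases hν : ν = b.dir
        · simp only [hF, hν, if_true]
          exact sum_longSel_eq_one hN (two_mul_L_le_sitesPerDir P t) (half_lt P) _
        · simp only [hF, hν, if_false]
          exact sum_hat_eq_one hN hN' (half_lt P) _
    _ = 1 := Finset.prod_const_one

/-- The weight is a function of the two directions and of the coordinatewise DIFFERENCES `b₋ − centre(e₋)` only. [folklore] -/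
theorem hatW_congr (w : PBond P t → PBond P (t + 1) → ℝ)
    (hw : ∀ b e, w b e = if e.dir = b.dir ∧ (b.src b.dir - emb e.src b.dir).val < P.L then
      ∏ ν ∈ Finset.univ.erase b.dir, max 0 (1 - ((rel (emb e.src) b.src ν).natAbs : ℝ) / P.L) else 0)
    {b b' : PBond P t} {e e' : PBond P (t + 1)} (hd : b'.dir = b.dir) (hd' : e'.dir = e.dir)
    (hdiff : ∀ ν, b'.src ν - emb e'.src ν = b.src ν - emb e.src ν) : w b' e' = w b e := by
  rw [hw, hw]
  simp only [hd, hd', rel_apply, hdiff]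

/-- **COARSE TRANSLATION INVARIANCE OF THE HAT MASS**: `Σ_x w ⟨x, μ⟩ ⟨y, μ⟩` does not depend on the centre `y` (translate the fine
sites by `centre(y′) − centre(y)`). [folklore] -/
theorem sum_hatW_src_eq (w : PBond P t → PBond P (t + 1) → ℝ)
    (hw : ∀ b e, w b e = if e.dir = b.dir ∧ (b.src b.dir - emb e.src b.dir).val < P.L then
      ∏ ν ∈ Finset.univ.erase b.dir, max 0 (1 - ((rel (emb e.src) b.src ν).natAbs : ℝ) / P.L) else 0)
    (μ : Fin P.d) (y y' : Site P (t + 1)) :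
    ∑ x : Site P t, w ⟨x, μ⟩ ⟨y', μ⟩ = ∑ x : Site P t, w ⟨x, μ⟩ ⟨y, μ⟩ := by
  refine (Fintype.sum_equiv (⟨fun x ν => x ν + (emb y' ν - emb y ν), fun x ν => x ν - (emb y' ν - emb y ν),
    fun x => funext fun ν => add_sub_cancel_right _ _, fun x => funext fun ν => sub_add_cancel _ _⟩ : Site P t ≃ Site P t)
    (fun x => w ⟨x, μ⟩ ⟨y, μ⟩) (fun x => w ⟨x, μ⟩ ⟨y', μ⟩) fun x => ?_).symm
  refine (hatW_congr w hw (b := ⟨x, μ⟩) (b' := ⟨fun ν => x ν + (emb y' ν - emb y ν), μ⟩) (e := ⟨y, μ⟩) (e' := ⟨y', μ⟩)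
    rfl rfl fun ν => ?_).symm
  show x ν + (emb y' ν - emb y ν) - emb y' ν = x ν - emb y ν
  ring

/-- **THE HAT MASS OF ONE COARSE BOND IS `L^d`**: `Σ_b w b e = L^d` (standing range) — by double counting: summing the partition of unity over the
`|T^{(t)}| = (N′L)^d` parallel fine bonds and using translation invariance over the `N′^d` centres. [cite: Balaban1985RegularSpaces, (1.29) p.81] -/
theorem sum_hatW_eq_pow (ht : t + 1 ≤ P.m + P.K) (w : PBond P t → PBond P (t + 1) → ℝ)
    (hw : ∀ b e, w b e = if e.dir = b.dir ∧ (b.src b.dir - emb e.src b.dir).val < P.L then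
      ∏ ν ∈ Finset.univ.erase b.dir, max 0 (1 - ((rel (emb e.src) b.src ν).natAbs : ℝ) / P.L) else 0)
    (e : PBond P (t + 1)) : ∑ b, w b e = (P.L : ℝ) ^ P.d := by
  -- only the parallel fine bonds count
  have h1 : ∑ b, w b e = ∑ x : Site P t, w ⟨x, e.dir⟩ e := by
    rw [sum_pbond]
    refine Finset.sum_congr rfl fun x _ => ?_
    rw [Finset.sum_eq_single e.dir (fun μ _ hμ => by rw [hw, if_neg (fun h => hμ h.1.symm)]) (fun h => absurd (Finset.mem_univ _) h)]
  -- double counting: Σ_y Σ_x w ⟨x,μ⟩ ⟨y,μ⟩ = Σ_x 1 = |T^{(t)}|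
  have h2 : ∑ y : Site P (t + 1), ∑ x : Site P t, w ⟨x, e.dir⟩ ⟨y, e.dir⟩ = Fintype.card (Site P t) := by
    rw [Finset.sum_comm]
    calc ∑ x : Site P t, ∑ y : Site P (t + 1), w ⟨x, e.dir⟩ ⟨y, e.dir⟩ = ∑ x : Site P t, ∑ e', w ⟨x, e.dir⟩ e' :=
          Finset.sum_congr rfl fun x _ => (sum_hatW_eq_sum_src w hw ⟨x, e.dir⟩).symm
      _ = ∑ _x : Site P t, (1 : ℝ) := Finset.sum_congr rfl fun x _ => sum_hatW_eq_one ht w hw _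
      _ = Fintype.card (Site P t) := by rw [Finset.sum_const, Finset.card_univ, nsmul_eq_mul, mul_one]
  -- translation invariance: the left side is |T^{(t+1)}| copies of the mass of `e`
  have h3 : ∑ y : Site P (t + 1), ∑ x : Site P t, w ⟨x, e.dir⟩ ⟨y, e.dir⟩
      = Fintype.card (Site P (t + 1)) * ∑ x : Site P t, w ⟨x, e.dir⟩ ⟨e.src, e.dir⟩ := by
    rw [Finset.sum_congr rfl fun y _ => sum_hatW_src_eq w hw e.dir e.src y, Finset.sum_const, Finset.card_univ, nsmul_eq_mul]
  have hcard : (Fintype.card (Site P t) : ℝ) = (P.L : ℝ) ^ P.d * Fintype.card (Site P (t + 1)) := by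
    rw [Site.card_site_eq_mul_succ ht]; push_cast; ring
  have hpos : (0 : ℝ) < Fintype.card (Site P (t + 1)) := by exact_mod_cast Fintype.card_pos
  have key : (Fintype.card (Site P (t + 1)) : ℝ) * ∑ x : Site P t, w ⟨x, e.dir⟩ ⟨e.src, e.dir⟩
      = Fintype.card (Site P (t + 1)) * (P.L : ℝ) ^ P.d := by rw [← h3, h2, hcard, mul_comm]
  rw [h1]
  exact mul_left_cancel₀ hpos.ne' key

/-- **ON THE CENTRE LINE THE WEIGHT IS CONCENTRATED ON ITS OWN COARSE BOND**: `w (line e k) e = 1` for `k < L` (standing range). [cite: Balaban1984PropagatorsI, (1.7) p.18] -/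
theorem hatW_line_self (ht : t + 1 ≤ P.m + P.K) (w : PBond P t → PBond P (t + 1) → ℝ)
    (hw : ∀ b e, w b e = if e.dir = b.dir ∧ (b.src b.dir - emb e.src b.dir).val < P.L then
      ∏ ν ∈ Finset.univ.erase b.dir, max 0 (1 - ((rel (emb e.src) b.src ν).natAbs : ℝ) / P.L) else 0)
    (e : PBond P (t + 1)) {k : ℕ} (hk : k < P.L) : w (line e k) e = 1 := by
  have hN := P.sitesPerDir_eq_mul_succ ht
  have hkN : k < P.sitesPerDir t := by
    rw [hN]; have := two_mul_L_le_sitesPerDir P t; omega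
  rw [hw, if_pos]
  · refine Finset.prod_eq_one fun ν hν => ?_
    have hne : ν ≠ e.dir := Finset.ne_of_mem_erase hν
    rw [rel_apply]
    simp only [line, lineSite, Function.update_of_ne hne, sub_self, ZMod.valMinAbs_zero, Int.natAbs_zero, Nat.cast_zero,
      zero_div, sub_zero]
    exact max_eq_right zero_le_one
  · refine ⟨rfl, ?_⟩
    simp only [line, lineSite, Function.update_self, add_sub_cancel_left]
    rwa [ZMod.val_natCast_of_lt hkN]

/-- … and every OTHER coarse bond has weight `0` there (partition of unity + non-negativity). [folklore] -/
theorem hatW_line_of_ne (ht : t + 1 ≤ P.m + P.K) (w : PBond P t → PBond P (t + 1) → ℝ)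
    (hw : ∀ b e, w b e = if e.dir = b.dir ∧ (b.src b.dir - emb e.src b.dir).val < P.L then
      ∏ ν ∈ Finset.univ.erase b.dir, max 0 (1 - ((rel (emb e.src) b.src ν).natAbs : ℝ) / P.L) else 0)
    (e : PBond P (t + 1)) {k : ℕ} (hk : k < P.L) {e' : PBond P (t + 1)} (he' : e' ≠ e) : w (line e k) e' = 0 := by
  classical
  have hsum := sum_hatW_eq_one ht w hw (line e k)
  have hpair : ∑ x ∈ ({e, e'} : Finset (PBond P (t + 1))), w (line e k) x ≤ ∑ x, w (line e k) x :=
    Finset.sum_le_sum_of_subset_of_nonneg (Finset.subset_univ _) fun x _ _ => hatW_nonneg w hw _ x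
  rw [Finset.sum_pair he'.symm, hatW_line_self ht w hw e hk, hsum] at hpair
  exact le_antisymm (by linarith) (hatW_nonneg w hw _ _)

/-- **SUPPORT OF THE WEIGHTS** (locality): `w b e ≠ 0` forces `e ∥ b`, `b₋` in the half-open longitudinal slab `[centre(e₋), centre(e₋) + L·e_μ)`
(`0 ≤ (b₋ − centre(e₋))_μ < L` in the centred representative) and `|(b₋ − centre(e₋))_ν| < L` transversally — i.e. `e` is one of the `≤ 2^{d−1}`
coarse bonds parallel to `b` on the edges of the coarse cube column through `b`. [folklore] -/
theorem hatW_support (ht : t + 1 ≤ P.m + P.K) (w : PBond P t → PBond P (t + 1) → ℝ)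
    (hw : ∀ b e, w b e = if e.dir = b.dir ∧ (b.src b.dir - emb e.src b.dir).val < P.L then
      ∏ ν ∈ Finset.univ.erase b.dir, max 0 (1 - ((rel (emb e.src) b.src ν).natAbs : ℝ) / P.L) else 0)
    {b : PBond P t} {e : PBond P (t + 1)} (hbe : w b e ≠ 0) :
    e.dir = b.dir ∧ (0 ≤ rel (emb e.src) b.src b.dir ∧ rel (emb e.src) b.src b.dir < P.L) ∧
      ∀ ν, ν ≠ b.dir → (rel (emb e.src) b.src ν).natAbs < P.L := by
  have hN := P.sitesPerDir_eq_mul_succ ht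
  have h2L := two_mul_L_le_sitesPerDir P t
  rw [hw] at hbe
  split_ifs at hbe with hc
  · obtain ⟨hdir, hsel⟩ := hc
    refine ⟨hdir, ?_, fun ν hν => ?_⟩
    · have hle : (b.src b.dir - emb e.src b.dir).val ≤ P.sitesPerDir t / 2 := by
        rw [Nat.le_div_iff_mul_le two_pos]; omega
      rw [rel_apply, ZMod.valMinAbs_def_pos, if_pos hle]
      exact ⟨by positivity, by exact_mod_cast hsel⟩
    · have hfac : max 0 (1 - ((rel (emb e.src) b.src ν).natAbs : ℝ) / P.L) ≠ 0 := fun h0 =>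
        hbe (Finset.prod_eq_zero (Finset.mem_erase.mpr ⟨hν, Finset.mem_univ ν⟩) h0)
      have hLr : (0 : ℝ) < P.L := by exact_mod_cast P.L_pos
      by_contra hge
      push Not at hge
      apply hfac
      apply max_eq_left
      rw [sub_nonpos, one_le_div hLr]
      exact_mod_cast hge
  · exact absurd rfl hbe

end Weights

end Summit.QuantumFields.YangMills.Theorems.FluctuationComparisonRegPrIntLS2BetaWhitneyHatWeights
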